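import Literature.AlgebraicGeometry.Frobenioids.Cor411Sub
import Literature.AlgebraicGeometry.Frobenioids.BiratEquivPreservesUnitsOver
import Literature.AlgebraicGeometry.Frobenioids.Cor411iiAssemblyFSM
import Literature.AlgebraicGeometry.Frobenioids.BaseCategoryTheoreticityProofs
import Literature.AlgebraicGeometry.Frobenioids.EquivalenceUnitsTransport
import HarnessLib

/-!
# Frobenioids I, Corollary 4.11 — the two named facts of `Cor411Sub.lean`, reduced

Mochizuki, *The geometry of Frobenioids I: the general theory*, Kyushu J. Math. **62** (2008)
293–400, Cor. 4.11 (i), (ii) pp. 91–94 [cite: MochizukiFrdI2008, Cor. 4.11 p.91]; the author's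
*Comments* (2024) item (29)(v) (the proof of (ii) first reduces to unit-trivial type by (i)).

PROOF-ONLY companion of `Cor411Sub.lean` (typer abc-iut-L1-t3 / discharger abc-iut-L1-d6; cell fact rows
F-2325 `FrdI.BiratEquivPreservesUnits`, F-2326 `FrdI.Cor411iRestrict`; seat abc-iut-f-029). Nothing of
[FrdI] is restated; no new definitions.

* `PreFrobenioid.Birat.isBaseIdentity_map_of_baseSquare` — the ELEMENTARY core of sub-node L11 of
  Cor. 4.11 (ii) ("`Ψ^birat` preserves the base-identity endomorphisms [hence … '`O^×(−)`']", p. 93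
  ll. 44–46) ONCE A BASE SQUARE IS AVAILABLE: if `G : C₁^birat ⥤ C₂^birat` lies over `Ψ : C₁ ⥤ C₂`
  (`(C₁ → C₁^birat) ⋙ G ≅ Ψ ⋙ (C₂ → C₂^birat)`) and `Ψ` lies over some `Ψ^Base : D₁ ⥤ D₂`
  (`Ψ ⋙ Base₂ ≅ Base₁ ⋙ Ψ^Base`), then `G` carries base-identity endomorphisms of `C₁^birat → F_{0_{D₁}}`
  to base-identity endomorphisms of `C₂^birat → F_{0_{D₂}}`. Proof: a birational endomorphism is a
  fraction `α⁻¹ ∘ φ'` (`α` a co-angular pre-step, Prop. 4.4 (i)); it is base-identity iff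
  `Base(α) = Base(φ')`; the base square transports this equality to `Base(Ψ α) = Base(Ψ φ')`, and `G(α⁻¹φ')`
  is conjugate to `(Ψα)⁻¹ ∘ Ψφ'` in `C₂^birat` (bases being totally epimorphic, Def. 1.1).
* `PreFrobenioid.Birat.mapIso_mem_unitsSubgroup_of_baseSquares` — hence an EQUIVALENCE `E` of the
  birationalizations over `Ψ : C₁ ⥲ C₂`, with base squares for `Ψ` and `Ψ⁻¹`, and its quasi-inverse preserve
  `O^×(−)` (isomorphisms have Frobenius degree `1`; the square for `E⁻¹` over `Ψ⁻¹` is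
  `Birat.oneCommutes_inverse_of_over`, seat abc-iut-w4-d109).
* `FrdI.biratEquivPreservesUnits_of_cor411ii` — the named fact F-2325 FOLLOWS FROM the named fact
  `FrdI.Cor411ii` (F-0715: the base square of Cor. 4.11 (ii)), with no further input: in the tree Cor. 4.11
  (ii) is proved along the author's amended route (Comments 2024 (29)(v): `C → C^istr → C^un-tr`, file
  `Cor411iiAssemblyFSM.lean`), which does not pass through L11 at general `C`, so this is not circular;
  and `FrdI.biratEquivPreservesUnits_of_isOfFSMType` — the body of F-2325 PROVED OUTRIGHT over bases of
  FSM-type (`PreFrobenioid.cor411ii_ofFunctor_of_isOfFSMType`, seat abc-iut-L1-d6), the instance family the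
  cell consumes (`PadicBase`, `ArchBase` are of FSM-type). The `Thm42Setting` hypothesis of the fact is
  not used.
* `FrdI.cor411iRestrict_of_thm34iii_thm42i` — the named fact F-2326 from `FrdI.Thm34iii` and `FrdI.Thm42i`
  only: the Thm. 3.4 (i) input of `FrdI.cor411iRestrict_of_facts` is DISCHARGED by `FrdI.Thm34i_holds`
  (seat lineage abc-iut-L1). Its body over bases of FSM-type is `PreFrobenioid.cor411i_ofFunctor_of_isOfFSMType`
  (file `Cor411iOfFSMType.lean`), unconditional.
Nothing here is specific to the abc programme; no side is taken on any use of [FrdI] downstream.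
-/

namespace Literature.AlgebraicGeometry.Frobenioids

open CategoryTheory Opposite

universe w v v' u u'

namespace PreFrobenioid

namespace Birat

variable {D₁ : Type u} [Category.{v} D₁] {Φ₁ : D₁ᵒᵖ ⥤ CommMonCat.{w}}
  {C₁ : Type u'} [Category.{v'} C₁] {F₁ : C₁ ⥤ ElemFrobenioid Φ₁}
  {D₂ : Type u} [Category.{v} D₂] {Φ₂ : D₂ᵒᵖ ⥤ CommMonCat.{w}}
  {C₂ : Type u'} [Category.{v'} C₂] {F₂ : C₂ ⥤ ElemFrobenioid Φ₂}

/-- For isomorphic functors `η : K ≅ K'`, `K'(g) = η⁻¹ ∘ K(g) ∘ η` read as `K(g) = η ∘ K'(g) ∘ η⁻¹`.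
[cite: MochizukiFrdI2008, Cor. 4.10 p.91] -/
private theorem map_eq_hom_map_inv {X : Type*} [Category X] {Y : Type*} [Category Y] {K K' : X ⥤ Y}
    (η : K ≅ K') {A B : X} (g : A ⟶ B) : K.map g = η.hom.app A ≫ K'.map g ≫ η.inv.app B := by
  rw [← Category.assoc, ← η.hom.naturality g, Category.assoc, Iso.hom_inv_id_app, Category.comp_id]

set_option backward.isDefEq.respectTransparency false in
/-- **[FrdI] Cor. 4.11 (ii), sub-node L11, elementary core** (p. 93 ll. 44–46: "`Ψ^birat` preserves the
base-identity endomorphisms"), GIVEN a base square: let `G : C₁^birat ⥤ C₂^birat` lie over `Ψ : C₁ ⥤ C₂`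
and `Ψ` over `Ψ^Base : D₁ ⥤ D₂`. Then `G` carries base-identity endomorphisms of `C₁^birat → F_{0_{D₁}}` to
base-identity endomorphisms of `C₂^birat → F_{0_{D₂}}`. (A birational endomorphism `α⁻¹ ∘ φ'` is
base-identity iff `Base(α) = Base(φ')`; this equality is transported by `Ψ^Base`, and `G(α⁻¹ ∘ φ')` is
conjugate to `(Ψα)⁻¹ ∘ Ψφ'`; `D₂` is totally epimorphic.) [cite: MochizukiFrdI2008, Cor. 4.11 (ii) p.93] -/
theorem isBaseIdentity_map_of_baseSquare (hF₁ : IsFrobenioid F₁) (hsq₁ : HasBiratSquares F₁)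
    (hF₂ : IsFrobenioid F₂) (hsq₂ : HasBiratSquares F₂)
    (G : Birat F₁ hF₁ hsq₁ ⥤ Birat F₂ hF₂ hsq₂) (Ψ : C₁ ⥤ C₂)
    (sq : toBirat F₁ hF₁ hsq₁ ⋙ G ≅ Ψ ⋙ toBirat F₂ hF₂ hsq₂)
    (ΨBase : D₁ ⥤ D₂)
    (τ : Ψ ⋙ (PreFrobenioidData.ofFunctor Φ₂ F₂).base ≅ (PreFrobenioidData.ofFunctor Φ₁ F₁).base ⋙ ΨBase)
    {X : Birat F₁ hF₁ hsq₁} {φ : X ⟶ X} (hφ : IsBaseIdentity (Birat.toElemZero hF₁ hsq₁) φ) :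
    IsBaseIdentity (Birat.toElemZero hF₂ hsq₂) (G.map φ) := by
  -- `φ = [(α, φ')]` with `α ≫ φ = φ'` after `C₁ → C₁^birat`
  obtain ⟨f, rfl⟩ := Birat.homMk_surjective φ
  have hkey := toBirat_map_den_comp_homMk hF₁ hsq₁ f
  -- (1) `Base(α) = Base(φ')` in `D₁`
  have hφ₀ : (biratOps hF₁ hsq₁).base.map
      (Birat.homMk f : (toBirat F₁ hF₁ hsq₁).obj X.out ⟶ (toBirat F₁ hF₁ hsq₁).obj X.out) = 𝟙 _ := hφ
  have h1 : (biratOps hF₁ hsq₁).base.map ((toBirat F₁ hF₁ hsq₁).map f.den) =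
      (biratOps hF₁ hsq₁).base.map ((toBirat F₁ hF₁ hsq₁).map f.num) := by
    have h := congrArg (biratOps hF₁ hsq₁).base.map hkey
    rw [Functor.map_comp, hφ₀, Category.comp_id] at h
    exact h
  have hb₁ : Base F₁ f.den = Base F₁ f.num :=
    ((biratOps_base_map_toBirat f.den).symm.trans h1).trans (biratOps_base_map_toBirat f.num)
  -- (2) `Base(Ψ α) = Base(Ψ φ')` in `D₂`, by the base square
  have hb₂ : (Ψ ⋙ (PreFrobenioidData.ofFunctor Φ₂ F₂).base).map f.den =
      (Ψ ⋙ (PreFrobenioidData.ofFunctor Φ₂ F₂).base).map f.num := by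
    rw [map_eq_hom_map_inv τ f.den, map_eq_hom_map_inv τ f.num]
    have e : ((PreFrobenioidData.ofFunctor Φ₁ F₁).base ⋙ ΨBase).map f.den =
        ((PreFrobenioidData.ofFunctor Φ₁ F₁).base ⋙ ΨBase).map f.num := by
      change ΨBase.map (Base F₁ f.den) = ΨBase.map (Base F₁ f.num)
      rw [hb₁]
    rw [e]
  have hb₂' : Base F₂ (Ψ.map f.den) = Base F₂ (Ψ.map f.num) := hb₂
  -- (3) `G(α) ≫ G(φ) = G(φ')`, rewritten through the square over `Ψ`
  have hG : G.map ((toBirat F₁ hF₁ hsq₁).map f.den) ≫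
      G.map (Birat.homMk f : (toBirat F₁ hF₁ hsq₁).obj X.out ⟶ (toBirat F₁ hF₁ hsq₁).obj X.out) =
        G.map ((toBirat F₁ hF₁ hsq₁).map f.num) := by
    rw [← G.map_comp, hkey]
  have s1 : G.map ((toBirat F₁ hF₁ hsq₁).map f.den) =
      sq.hom.app f.src ≫ (Ψ ⋙ toBirat F₂ hF₂ hsq₂).map f.den ≫ sq.inv.app X.out :=
    map_eq_hom_map_inv sq f.den
  have s2 : G.map ((toBirat F₁ hF₁ hsq₁).map f.num) =
      sq.hom.app f.src ≫ (Ψ ⋙ toBirat F₂ hF₂ hsq₂).map f.num ≫ sq.inv.app X.out :=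
    map_eq_hom_map_inv sq f.num
  rw [s1, s2] at hG
  -- the conjugate `v := sq⁻¹ ≫ G(φ) ≫ sq` satisfies `Ψα ≫ v = Ψφ'` in `C₂^birat`
  have hv : (Ψ ⋙ toBirat F₂ hF₂ hsq₂).map f.den ≫ (sq.inv.app X.out ≫
      G.map (Birat.homMk f : (toBirat F₁ hF₁ hsq₁).obj X.out ⟶ (toBirat F₁ hF₁ hsq₁).obj X.out) ≫
        sq.hom.app X.out) = (Ψ ⋙ toBirat F₂ hF₂ hsq₂).map f.num := by
    have h := congrArg (fun g => sq.inv.app f.src ≫ g ≫ sq.hom.app X.out) hG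
    simpa only [Category.assoc, Iso.inv_hom_id_app_assoc, Iso.inv_hom_id_app, Category.comp_id]
      using h
  -- (4) hence `Base(v) = id` (`D₂` totally epimorphic)
  have hbase := congrArg (biratOps hF₂ hsq₂).base.map hv
  rw [Functor.map_comp] at hbase
  have c1 : (biratOps hF₂ hsq₂).base.map ((Ψ ⋙ toBirat F₂ hF₂ hsq₂).map f.den) =
      Base F₂ (Ψ.map f.den) := biratOps_base_map_toBirat (Ψ.map f.den)
  have c2 : (biratOps hF₂ hsq₂).base.map ((Ψ ⋙ toBirat F₂ hF₂ hsq₂).map f.num) =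
      Base F₂ (Ψ.map f.num) := biratOps_base_map_toBirat (Ψ.map f.num)
  rw [c1, c2, hb₂'] at hbase
  haveI := hF₂.isPreFrobenioid.isTotallyEpimorphic_base.epi (Base F₂ (Ψ.map f.num))
  have hvid : (biratOps hF₂ hsq₂).base.map (sq.inv.app X.out ≫
      G.map (Birat.homMk f : (toBirat F₁ hF₁ hsq₁).obj X.out ⟶ (toBirat F₁ hF₁ hsq₁).obj X.out) ≫
        sq.hom.app X.out) = 𝟙 _ :=
    (cancel_epi (Base F₂ (Ψ.map f.num))).mp (hbase.trans (Category.comp_id _).symm)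
  have hvid' : IsBaseIdentity (Birat.toElemZero hF₂ hsq₂) (sq.inv.app X.out ≫
      G.map (Birat.homMk f : (toBirat F₁ hF₁ hsq₁).obj X.out ⟶ (toBirat F₁ hF₁ hsq₁).obj X.out) ≫
        sq.hom.app X.out) := hvid
  -- (5) `G(φ)` is conjugate to `v`
  have h := hvid'.conj_iso (sq.app X.out).symm
  have e : (sq.app X.out).symm.inv ≫ (sq.inv.app X.out ≫
      G.map (Birat.homMk f : (toBirat F₁ hF₁ hsq₁).obj X.out ⟶ (toBirat F₁ hF₁ hsq₁).obj X.out) ≫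
        sq.hom.app X.out) ≫ (sq.app X.out).symm.hom =
      G.map (Birat.homMk f : (toBirat F₁ hF₁ hsq₁).obj X.out ⟶ (toBirat F₁ hF₁ hsq₁).obj X.out) := by
    simp only [Iso.symm_inv, Iso.symm_hom, Iso.app_hom, Iso.app_inv, Category.assoc,
      Iso.hom_inv_id_app, Iso.hom_inv_id_app_assoc]
    exact Category.comp_id _
  rw [e] at h
  exact h

/-- **[FrdI] Cor. 4.11 (ii), sub-node L11, for an equivalence `E` of THE birationalizations lying over
`Ψ : C₁ ⥲ C₂`, GIVEN base squares for `Ψ` and `Ψ⁻¹`**: `E` and its quasi-inverse carry `O^×(−)` of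
`C₁^birat → F_{0_{D₁}}` resp. `C₂^birat → F_{0_{D₂}}` into `O^×(−)` (p. 93 ll. 44–46; isomorphisms have
Frobenius degree `1`, so only the base-identity clause is at stake; `E⁻¹` lies over `Ψ⁻¹` by
`Birat.oneCommutes_inverse_of_over`). [cite: MochizukiFrdI2008, Cor. 4.11 (ii) p.93] -/
theorem mapIso_mem_unitsSubgroup_of_baseSquares (hF₁ : IsFrobenioid F₁) (hsq₁ : HasBiratSquares F₁)
    (hF₂ : IsFrobenioid F₂) (hsq₂ : HasBiratSquares F₂) (Ψ : C₁ ≌ C₂)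
    (E : Birat F₁ hF₁ hsq₁ ≌ Birat F₂ hF₂ hsq₂)
    (sq : toBirat F₁ hF₁ hsq₁ ⋙ E.functor ≅ Ψ.functor ⋙ toBirat F₂ hF₂ hsq₂)
    (ΨBase : D₁ ⥤ D₂)
    (τ : Ψ.functor ⋙ (PreFrobenioidData.ofFunctor Φ₂ F₂).base ≅ (PreFrobenioidData.ofFunctor Φ₁ F₁).base ⋙ ΨBase)
    (ΨBase' : D₂ ⥤ D₁)
    (τ' : Ψ.inverse ⋙ (PreFrobenioidData.ofFunctor Φ₁ F₁).base ≅ (PreFrobenioidData.ofFunctor Φ₂ F₂).base ⋙ ΨBase') :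
    (∀ (X : Birat F₁ hF₁ hsq₁) (u : Aut X), u ∈ (biratOps hF₁ hsq₁).unitsSubgroup X →
        E.functor.mapIso u ∈ (biratOps hF₂ hsq₂).unitsSubgroup (E.functor.obj X)) ∧
      ∀ (Y : Birat F₂ hF₂ hsq₂) (u : Aut Y), u ∈ (biratOps hF₂ hsq₂).unitsSubgroup Y →
        E.inverse.mapIso u ∈ (biratOps hF₁ hsq₁).unitsSubgroup (E.inverse.obj Y) := by
  obtain ⟨sq'⟩ := oneCommutes_inverse_of_over hF₁ hsq₁ hF₂ hsq₂ Ψ E sq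
  refine ⟨fun X u hu => ⟨?_, degFr_iso_hom _ (E.functor.mapIso u)⟩,
    fun Y u hu => ⟨?_, degFr_iso_hom _ (E.inverse.mapIso u)⟩⟩
  · exact isBaseIdentity_map_of_baseSquare hF₁ hsq₁ hF₂ hsq₂ E.functor Ψ.functor sq ΨBase τ hu.1
  · exact isBaseIdentity_map_of_baseSquare hF₂ hsq₂ hF₁ hsq₁ E.inverse Ψ.inverse sq'.symm ΨBase' τ' hu.1

end Birat

end PreFrobenioid

namespace FrdI

/-- The `Cor411Setting` of Cor. 4.11 is symmetric in `(C₁, C₂, Ψ) ↔ (C₂, C₁, Ψ⁻¹)`.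
[cite: MochizukiFrdI2008, Cor. 4.11 p.91] -/
theorem cor411Setting_symm {D₁ : Type u} [Category.{v} D₁] {Φ₁ : D₁ᵒᵖ ⥤ CommMonCat.{w}}
    {C₁ : Type u'} [Category.{v'} C₁] {D₂ : Type u} [Category.{v} D₂] {Φ₂ : D₂ᵒᵖ ⥤ CommMonCat.{w}}
    {C₂ : Type u'} [Category.{v'} C₂] {F₁ : C₁ ⥤ ElemFrobenioid Φ₁} {F₂ : C₂ ⥤ ElemFrobenioid Φ₂}
    {Ψ : C₁ ≌ C₂}
    (hs : (PreFrobenioidData.ofFunctor Φ₁ F₁).Cor411Setting (PreFrobenioidData.ofFunctor Φ₂ F₂) Ψ) :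
    (PreFrobenioidData.ofFunctor Φ₂ F₂).Cor411Setting (PreFrobenioidData.ofFunctor Φ₁ F₁) Ψ.symm :=
  { divSlim := ⟨hs.divSlim.2, hs.divSlim.1⟩
    standard := ⟨hs.standard.2, hs.standard.1⟩
    hypB := fun g₂ g₁ => ⟨(hs.hypB g₁ g₂).2, (hs.hypB g₁ g₂).1⟩ }

/-- **F-2325 ⇐ F-0715.** The named fact `FrdI.BiratEquivPreservesUnits` ([FrdI] Cor. 4.11 (ii), sub-node
L11, p. 93 ll. 36–46) follows from the named fact `FrdI.Cor411ii` (the `1`-unique `Ψ^Base` of Cor. 4.11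
(ii), p. 91): apply `FrdI.Cor411ii` to `Ψ` and to `Ψ⁻¹` to get the two base squares, then
`PreFrobenioid.Birat.mapIso_mem_unitsSubgroup_of_baseSquares`. (Not circular in the tree: Cor. 4.11 (ii) is
proved along the author's amended route, Comments 2024 (29)(v), which avoids L11 at general `C`.) The
`Thm42Setting` hypothesis of the fact is not needed. [cite: MochizukiFrdI2008, Cor. 4.11 (ii) p.93] -/
theorem biratEquivPreservesUnits_of_cor411ii (h : Cor411ii.{w, v, v', u, u'}) :
    BiratEquivPreservesUnits.{w, v, v', u, u'} := by
  intro D₁ _ Φ₁ C₁ _ D₂ _ Φ₂ C₂ _ F₁ F₂ hF₁ hsq₁ hF₂ hsq₂ hpf₁ hpf₂ Ψ hs _ E hsqE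
  obtain ⟨sq⟩ := hsqE
  obtain ⟨ΨB, ⟨-, ⟨τ⟩, -⟩, -⟩ := h F₁ F₂ hF₁ hF₂ hpf₁ hpf₂ Ψ hs
  obtain ⟨ΨB', ⟨-, ⟨τ'⟩, -⟩, -⟩ := h F₂ F₁ hF₂ hF₁ hpf₂ hpf₁ Ψ.symm (cor411Setting_symm hs)
  exact PreFrobenioid.Birat.mapIso_mem_unitsSubgroup_of_baseSquares hF₁ hsq₁ hF₂ hsq₂ Ψ E sq ΨB τ ΨB' τ'

/-- **F-2325 over bases of FSM-type, PROVED OUTRIGHT.** For Frobenioids `C_i → F_{Φ_i}` with `Φ_i`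
perf-factorial over bases `D_i` of FSM-type, and `Ψ : C₁ ⥲ C₂` in the setting of Cor. 4.11 (`D_i` Div-slim,
`C_i` of standard type, hypothesis (b)), EVERY equivalence `E : C₁^birat ⥲ C₂^birat` lying over `Ψ`, and its
quasi-inverse, preserve `O^×(−)` ([FrdI] Cor. 4.11 (ii) sub-node L11, p. 93 ll. 36–46): the base squares
come from `PreFrobenioid.cor411ii_ofFunctor_of_isOfFSMType` (Cor. 4.11 (ii) unconditional over FSM-type
bases). [cite: MochizukiFrdI2008, Cor. 4.11 (ii) p.93] -/
theorem biratEquivPreservesUnits_of_isOfFSMType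
    {D₁ : Type u} [Category.{v} D₁] {Φ₁ : D₁ᵒᵖ ⥤ CommMonCat.{w}} {C₁ : Type u'} [Category.{v'} C₁]
    {D₂ : Type u} [Category.{v} D₂] {Φ₂ : D₂ᵒᵖ ⥤ CommMonCat.{w}} {C₂ : Type u'} [Category.{v'} C₂]
    (F₁ : C₁ ⥤ ElemFrobenioid Φ₁) (F₂ : C₂ ⥤ ElemFrobenioid Φ₂)
    (hF₁ : PreFrobenioid.IsFrobenioid F₁) (hsq₁ : PreFrobenioid.HasBiratSquares F₁)
    (hF₂ : PreFrobenioid.IsFrobenioid F₂) (hsq₂ : PreFrobenioid.HasBiratSquares F₂)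
    (hpf₁ : ∀ X : D₁, IsPerfFactorial (Φ₁.obj (Opposite.op X)))
    (hpf₂ : ∀ X : D₂, IsPerfFactorial (Φ₂.obj (Opposite.op X)))
    (hD₁ : IsOfFSMType D₁) (hD₂ : IsOfFSMType D₂) (Ψ : C₁ ≌ C₂)
    (hs : (PreFrobenioidData.ofFunctor Φ₁ F₁).Cor411Setting (PreFrobenioidData.ofFunctor Φ₂ F₂) Ψ)
    (E : PreFrobenioid.Birat F₁ hF₁ hsq₁ ≌ PreFrobenioid.Birat F₂ hF₂ hsq₂)
    (sq : PreFrobenioid.toBirat F₁ hF₁ hsq₁ ⋙ E.functor ≅ Ψ.functor ⋙ PreFrobenioid.toBirat F₂ hF₂ hsq₂) :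
    (∀ (X : PreFrobenioid.Birat F₁ hF₁ hsq₁) (u : Aut X),
        u ∈ (PreFrobenioid.biratOps hF₁ hsq₁).unitsSubgroup X →
          E.functor.mapIso u ∈ (PreFrobenioid.biratOps hF₂ hsq₂).unitsSubgroup (E.functor.obj X)) ∧
      ∀ (Y : PreFrobenioid.Birat F₂ hF₂ hsq₂) (u : Aut Y),
        u ∈ (PreFrobenioid.biratOps hF₂ hsq₂).unitsSubgroup Y →
          E.inverse.mapIso u ∈ (PreFrobenioid.biratOps hF₁ hsq₁).unitsSubgroup (E.inverse.obj Y) := by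
  obtain ⟨ΨB, ⟨-, ⟨τ⟩, -⟩, -⟩ :=
    PreFrobenioid.cor411ii_ofFunctor_of_isOfFSMType hF₁ hF₂ Ψ hpf₁ hpf₂ hD₁ hD₂ hs
  obtain ⟨ΨB', ⟨-, ⟨τ'⟩, -⟩, -⟩ :=
    PreFrobenioid.cor411ii_ofFunctor_of_isOfFSMType hF₂ hF₁ Ψ.symm hpf₂ hpf₁ hD₂ hD₁ (cor411Setting_symm hs)
  exact PreFrobenioid.Birat.mapIso_mem_unitsSubgroup_of_baseSquares hF₁ hsq₁ hF₂ hsq₂ Ψ E sq ΨB τ ΨB' τ'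

/-- **F-2326 ⇐ F-0712 ∧ F-0716.** The named fact `FrdI.Cor411iRestrict` ([FrdI] Cor. 4.11 (i) for
`Ψ^istr`, print's reduced case, p. 92) from `FrdI.Thm34iii` and `FrdI.Thm42i` only — the Thm. 3.4 (i)
input of `FrdI.cor411iRestrict_of_facts` is discharged by `FrdI.Thm34i_holds`. (Over bases of FSM-type the
body of the fact is `PreFrobenioid.cor411i_ofFunctor_of_isOfFSMType`, unconditional.)
[cite: MochizukiFrdI2008, Cor. 4.11 (i) p.92] -/
theorem cor411iRestrict_of_thm34iii_thm42i (h34iii : Thm34iii.{w, v, v', u, u'})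
    (h42i : Thm42i.{w, v, v', u, u'}) : Cor411iRestrict.{w, v, v', u, u'} :=
  cor411iRestrict_of_facts Thm34i_holds h34iii h42i

end FrdI

end Literature.AlgebraicGeometry.Frobenioids
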